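import Mathlib
import Literature.NumberTheory.LFunctions.Zhang2022.SkeletonPartTwo
import Literature.NumberTheory.LFunctions.Zhang2022.Section14MeanSquareMajorant
import HarnessLib

/-!
# Zhang (2022), typed statements, slice L2-t4: §7, proof of Proposition 7.1, part (b)
# "The error term" — (7.12)–(7.15) and the steps `§7.u031`–`§7.u041`

Topic `Literature/NumberTheory/LFunctions/Zhang2022` (Landau–Siegel audit tree; verdict-neutral).
Y. Zhang, *Discrete mean estimates and the Landau–Siegel zero*, arXiv:2211.02515v1 (2022)
[Zhang2022LandauSiegel] — **an unrefereed manuscript under adjudication. Every `def … : Prop` below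
is a CLAIM OF THE MANUSCRIPT, STATED (as a named proposition), NOT ASSERTED; STATEMENT-ONLY:
typed ≠ discharged. WHAT THIS IS NOT: any claim about Theorems 1–2 of the manuscript or about
Landau–Siegel zeros.**

Slice (cell siegel-zhang, plan/L2/ASSIGNMENTS.md v1 row L2-t4): tex `lsz3__2_.tex` L1984–L2058,
PDF pp. 37–39, the subsection *Proof of Proposition 7.1: The error term*, which proves (7.11)
"`Σ_{p∼P} p^{β₃}𝔗₁₂(p) = o(𝔓)`". DAG nodes (plan/DAG.tsv ids, the first token of each docstring):
`Z22:Prop7.1.pf.b-error`, `Z22:(7.12)`–`Z22:(7.15)`, `Z22:§7.u031`–`Z22:§7.u041` (16), plus the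
four load-bearing PROSE claims of the subsection that carry no display (`|τ(θ̄)| ≤ r^{1/2}`; the
`l > P²` truncation "by Lemma 5.3"; "the total contribution from the terms with `1 < r < D` is
`O(P²D^{−c})`"; the `l ∉ 𝔌(Rh)` truncation "by Lemma 5.1"), each attached to the node it leads into.

Conventions (skel/INTERFACE.md §3, binding): `Skeleton.ForAllLarge` ("`D` sufficiently large"),
Assumption (A) `Skeleton.AssumptionA D χ` as an antecedent (standing from §5 on, tex L1560),
"`X ≪ Y`" ↦ `∃ C, … X ≤ C·Y`, an unspecified "`𝓛^c`" ↦ `Skeleton.ell D ^ k` with `∃ k : ℕ`, an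
unspecified "`D^{−c}`" ↦ `(D : ℝ) ^ (−c)` with `∃ c > 0`, "negligible" ↦ `≤ exp(−c𝓛¹⁰)` (the
manuscript's `ε = exp{−c𝓛¹⁰}`, tex L1062), "(7.2) for `𝐚`" ↦ `Skeleton.Adm72 D B a` (constants may
depend on `B`), `c′` of (2.13) an explicit parameter (it enters `β₃` and `κ`). Sums over `l ≥ 1`
without an upper limit are `tsum`s (junk value `0` if not summable — they converge absolutely where
the manuscript uses them, by the decay (5.9) of `Δ`); sums over `d, k` are finite by (7.2). Objects REUSED by
fully-qualified name, never restated: `Skeleton.kappaZ` (`κ`), `MeanSquareMajorant.conv κ a`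
(`κ ∗ a`), `Skeleton.DeltaW` (`Δ`), `Skeleton.primeWindow` (`p ∼ P`), `Skeleton.beta3`,
`Skeleton.Nsupp` (`⌈PT⁻²⌉`), `Skeleton.P1`, `Skeleton.bigP`, `Skeleton.bigT`, `Skeleton.t0`,
`Skeleton.ell`, `frakP`, `MeanSquareMajorant.tau 5` (`τ₅`), `GammaFactor.tau` (`τ(θ)`),
the cited §5 lemmas `Skeleton.Lemma51/53/54/56` (only named in docstrings: each step is typed as
the manuscript's claim, the lemma it invokes is the discharger's input).

Interfaces (ASSIGNMENTS §D): `𝔗₁₂(p)` ((7.9)) and (7.11) are OWNED by slice L2-t3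
(`Section7bStatements.frakT12`, `….Eq711`); until that file lands they are the marked stubs
`Iface.frakT12`, `Iface.Eq711` below (same name and intended type; bodies = the printed (7.9),
(7.11) read literally; TODO-merge by import + a bridging lemma, discharger work).

Objects introduced here (owned by this slice): `innerSum712` (the `θ`-sum of (7.12)), `frakS`
(`𝔰(r,h,d;θ)`, §7.u032), `tripleSet` (the range of `Σ′_{d,h,r}`, tex L2008), `InRange735` (the
ranges of (7.15), §7.u035), `frakI` (`𝔌(y)`, §7.u036) with `natI` (its integers), `frakSstar`
(`𝔰*(R,r,h,d;θ)`, §7.u037), `lPoly`, `pPoly` (the two Dirichlet polynomials of §7.u038–u040),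
and three rendering helpers `gaussBar` (`τ(θ̄)` for a character to a bound-variable modulus),
`dyadic` (`R ≤ r < 2R`), `tail7P2` (the `l > P²` tail of `𝔰`).

Priors of record touching this slice (NOT verdicts; the adjudication teams decide): read1-8
(the range `dhr < P₁` of (7.13) vs. the support `PT⁻²` of (7.2) — typed AS PRINTED, `AMBIGUITY`
flagged on `tripleSet`), read1-9 (the `|t| > D` tail of (7.14) in §7.u033 — typed AS PRINTED),
read1-13 (vi) ("By Lemma 5.1" at tex L2036 names Lemma 5.3's localisation — typed AS PRINTED).

## References

* Y. Zhang, arXiv:2211.02515v1 (2022), §7 pp. 37–39, (7.12)–(7.15); §5 Lemmas 5.1, 5.3, 5.4,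
  5.6; (7.2), (7.9), (7.11); (2.21) `P₁`. [cite: Zhang2022LandauSiegel, §7 pp. 37–39]
-/

noncomputable section

open Complex Real MeasureTheory
open Literature.NumberTheory.LFunctions.Zhang2022

namespace Literature.NumberTheory.LFunctions.Zhang2022.Section7cStatements

/-! ## Rendering helpers (no mathematical content of their own) -/

/-- `τ(θ̄)` for a character `θ (mod k)`: the tree's `GammaFactor.tau θ⁻¹` (Mathlib's
`gaussSum θ⁻¹ stdAddChar`, `θ̄ = θ⁻¹`), packaged for a modulus `k` that is a bound summation variable
(the instance `NeZero k` is supplied from `k ≠ 0`; junk value `0` at the vacuous `k = 0`).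
[cite: Zhang2022LandauSiegel, §7 p.37, tex L1968] -/
def gaussBar (k : ℕ) (θ : DirichletCharacter ℂ k) : ℂ :=
  if hk : k = 0 then 0 else @GammaFactor.tau k ⟨hk⟩ θ⁻¹

/-- The dyadic block "`R ≤ r < 2R`" of moduli, as a finite set of naturals (`R` real).
[cite: Zhang2022LandauSiegel, §7 (7.15) p.38, tex L2025] -/
def dyadic (R : ℝ) : Finset ℕ :=
  (Finset.range ⌈2 * R⌉₊).filter fun r => R ≤ (r : ℝ) ∧ (r : ℝ) < 2 * R

/-! ## Interface stubs for objects owned by slice L2-t3 (`Section7bStatements`) -/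

namespace Iface

open scoped Classical in
/-- `Z22:§7.u030` IFACE-STUB of `𝔗₁₂(p)`, owned by L2-t3 (`Section7bStatements.frakT12`, same name and
argument order `(c′) (D p) (𝐚₁ 𝐚₂)` as the owner's staged decl); TODO-merge (import + bridging lemma).
The printed definition (tex L1968, p.37), read literally over the skeleton's objects:
`𝔗₁₂(p) = Σ_d (1/d) Σ_l Σ_{(k,l)=1} (κ∗a₁)(dl)a₂(dk)/(kφ(k)) · (Σ′_{θ mod k} τ(θ̄)θ(l)θ̄(−p)) · Δ(l/(pk))`,
`Σ′` over the non-principal characters `θ (mod k)`; the sums over `d, k` are finite by (7.2)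
(`a₂(dk) = 0` for `dk ≥ PT⁻²`, range `Skeleton.Nsupp`), the sum over `l` is a series.
[cite: Zhang2022LandauSiegel, §7 p.37, tex L1968] -/
def frakT12 (c' : ℝ) (D p : ℕ) (a₁ a₂ : ℕ → ℂ) : ℂ :=
  ∑ d ∈ Finset.Ico 1 (Skeleton.Nsupp D), 1 / (d : ℂ) *
    ∑' l : ℕ, ∑ k ∈ (Finset.Ico 1 (Skeleton.Nsupp D)).filter (fun k => Nat.Coprime k l),
      MeanSquareMajorant.conv (Skeleton.kappaZ c' D) a₁ (d * l) * a₂ (d * k) /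
          ((k : ℂ) * (Nat.totient k : ℂ)) *
        (∑ θ : DirichletCharacter ℂ k,
          if θ ≠ 1 then gaussBar k θ * θ (l : ZMod k) * θ⁻¹ (-(p : ZMod k)) else 0) *
        Skeleton.DeltaW D ((l : ℝ) / ((p : ℝ) * k))

/-- `Z22:(7.11)` IFACE-STUB of the claim (7.11), owned by L2-t3 (`Section7bStatements.Eq711`);
TODO-merge. As printed (tex L1980, p.37): "`Σ_{p∼P} p^{β₃}𝔗₁₂(p) = o(𝔓)`", for `𝐚₁, 𝐚₂`
satisfying (7.2), under (A). CLAIM. [cite: Zhang2022LandauSiegel, §7 (7.11) p.37, tex L1980] -/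
def Eq711 (c' : ℝ) : Prop :=
  ∀ B : ℝ, ∀ ε : ℝ, 0 < ε → Skeleton.ForAllLarge fun D _ χ => Skeleton.AssumptionA D χ →
    ∀ a₁ a₂ : ℕ → ℂ, Skeleton.Adm72 D B a₁ → Skeleton.Adm72 D B a₂ →
      ‖∑ p ∈ Skeleton.primeWindow D, (p : ℂ) ^ Skeleton.beta3 c' D * frakT12 c' D p a₁ a₂‖
        ≤ ε * frakP D

end Iface

/-! ## (7.12): changing the order of summation -/

open scoped Classical in
/-- `Z22:(7.12)` (inner part) OBJECT: the sum over the non-principal `θ (mod k)` on the right of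
(7.12) for fixed `d, k`:
`Σ′_{θ mod k} τ(θ̄) Σ_l (κ∗a₁)(dl)θ(l) Σ_{p∼P} p^{β₃}θ̄(−p)Δ(l/(pk))` (the `l`-sum a series).
[cite: Zhang2022LandauSiegel, §7 (7.12) p.37, tex L1991] -/
def innerSum712 (c' : ℝ) (D : ℕ) (a₁ : ℕ → ℂ) (d k : ℕ) : ℂ :=
  ∑ θ : DirichletCharacter ℂ k,
    if θ ≠ 1 then
      gaussBar k θ *
        ∑' l : ℕ, MeanSquareMajorant.conv (Skeleton.kappaZ c' D) a₁ (d * l) * θ (l : ZMod k) *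
          ∑ p ∈ Skeleton.primeWindow D, (p : ℂ) ^ Skeleton.beta3 c' D * θ⁻¹ (-(p : ZMod k)) *
            Skeleton.DeltaW D ((l : ℝ) / ((p : ℝ) * k))
    else 0

/-- `Z22:(7.12)` CLAIM. "Changing the order of summation gives
`Σ_{p∼P} p^{β₃}𝔗₁₂(p) = Σ_d (1/d) Σ_k a₂(dk)/(kφ(k)) Σ′_{θ mod k} τ(θ̄) Σ_l (κ∗a₁)(dl)θ(l)
 × Σ_{p∼P} p^{β₃}θ̄(−p)Δ(l/(pk))`" — refines `Skeleton.Ded71 c′` (error-term part), first step.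
The condition `(k,l) = 1` of (7.9) is absorbed by `θ(l)`. `𝔗₁₂` = `Iface.frakT12` (owner L2-t3).
[cite: Zhang2022LandauSiegel, §7 (7.12) p.37, tex L1991] -/
def Eq712 (c' : ℝ) : Prop :=
  ∀ B : ℝ, Skeleton.ForAllLarge fun D _ χ => Skeleton.AssumptionA D χ →
    ∀ a₁ a₂ : ℕ → ℂ, Skeleton.Adm72 D B a₁ → Skeleton.Adm72 D B a₂ →
      ∑ p ∈ Skeleton.primeWindow D, (p : ℂ) ^ Skeleton.beta3 c' D * Iface.frakT12 c' D p a₁ a₂ =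
        ∑ d ∈ Finset.Ico 1 (Skeleton.Nsupp D), 1 / (d : ℂ) *
          ∑ k ∈ Finset.Ico 1 (Skeleton.Nsupp D),
            a₂ (d * k) / ((k : ℂ) * (Nat.totient k : ℂ)) * innerSum712 c' D a₁ d k

/-! ## `§7.u031`–`§7.u032`: reduction to primitive characters, the sums `𝔰(r,h,d;θ)` -/

/-- `Z22:§7.u032` OBJECT `𝔰(r,h,d;θ)` for a character `θ (mod r)`:
`𝔰(r,h,d;θ) = Σ_{(l,h)=1} (κ∗a₁)(dl)θ(l) Σ_{p∼P} p^{β₃}θ̄(p)Δ(l/(phr))` (a series in `l ≥ 1`;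
note `θ̄(p)` here against `θ̄(−p)` in (7.12), as printed).
[cite: Zhang2022LandauSiegel, §7 p.37, tex L2001] -/
def frakS (c' : ℝ) (D : ℕ) (a₁ : ℕ → ℂ) (r h d : ℕ) (θ : DirichletCharacter ℂ r) : ℂ :=
  ∑' l : ℕ,
    if Nat.Coprime l h then
      MeanSquareMajorant.conv (Skeleton.kappaZ c' D) a₁ (d * l) * θ (l : ZMod r) *
        ∑ p ∈ Skeleton.primeWindow D, (p : ℂ) ^ Skeleton.beta3 c' D * θ⁻¹ (p : ZMod r) *
          Skeleton.DeltaW D ((l : ℝ) / ((p : ℝ) * h * r))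
    else 0

/-- `Z22:§7.u031` (lead-in prose, tex L1997) CLAIM. "If `k = hr`, `r > 1` and `θ (mod k)` is induced
by a primitive character `θ* (mod r)`, then `|τ(θ̄)| ≤ r^{1/2}`." (A classical evaluation, typed as
the manuscript's claim; `θ` = `θ*` lifted to level `hr` by `changeLevel`.)
[cite: Zhang2022LandauSiegel, §7 p.37, tex L1997] -/
def Step7u031tau : Prop :=
  ∀ (h r : ℕ) (θs : DirichletCharacter ℂ r), 0 < h → 1 < r → θs.IsPrimitive →
    ‖gaussBar (h * r) (DirichletCharacter.changeLevel (Nat.dvd_mul_left r h) θs)‖ ≤ Real.sqrt r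

open scoped Classical in
/-- `Z22:§7.u031` CLAIM. "Thus, the inner sum over the non-principal `θ (mod k)` above [in (7.12)] is
`≪ Σ_{hr=k, r>1} r^{1/2} Σ*_{θ mod r} |𝔰(r,h,d;θ)|`" (`Σ*` over primitive characters), for `d, k`
in the support range of `a₂(dk)` ((7.2): `dk < PT⁻²`, whence `p ∤ k` for `p ∼ P`).
[cite: Zhang2022LandauSiegel, §7 p.37, tex L1998] -/
def Step7u031 (c' : ℝ) : Prop :=
  ∀ B : ℝ, ∃ C : ℝ, Skeleton.ForAllLarge fun D _ χ => Skeleton.AssumptionA D χ →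
    ∀ a₁ : ℕ → ℂ, Skeleton.Adm72 D B a₁ → ∀ d k : ℕ, 0 < d → 0 < k →
      ((d * k : ℕ) : ℝ) < Skeleton.bigP D / Skeleton.bigT D ^ 2 →
        ‖innerSum712 c' D a₁ d k‖ ≤
          C * ∑ x ∈ k.divisorsAntidiagonal,
            if 1 < x.2 then
              Real.sqrt x.2 * ∑ θ : DirichletCharacter ℂ x.2,
                if θ.IsPrimitive then ‖frakS c' D a₁ x.2 x.1 d θ‖ else 0
            else 0

/-! ## (7.13) and its range `Σ′_{d,h,r}` -/

/-- `Z22:(7.13)` (range, prose tex L2008) OBJECT: the index set of "`Σ′_{d,h,r}`, a sum over the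
triples `{d,h,r}` satisfying `dhr < P₁` and `r > 1`" (`d, h ≥ 1`; `P₁ = P^{0.504}` (2.21)).
AMBIGUITY: (7.2) lets `a₂(dk)` live up to `dk < PT⁻²`, which exceeds `P₁`; the printed range
`dhr < P₁` is typed AS PRINTED (alternative reading: `P₁ ↦ PT⁻²`; prior read1-8; `GAP?` posted).
[cite: Zhang2022LandauSiegel, §7 (7.13) p.38, tex L2008] -/
def tripleSet (D : ℕ) : Finset (ℕ × ℕ × ℕ) :=
  ((Finset.Ico 1 ⌈Skeleton.P1 D⌉₊) ×ˢ
      ((Finset.Ico 1 ⌈Skeleton.P1 D⌉₊) ×ˢ (Finset.Ico 2 ⌈Skeleton.P1 D⌉₊))).filter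
    fun x => ((x.1 * x.2.1 * x.2.2 : ℕ) : ℝ) < Skeleton.P1 D

open scoped Classical in
/-- `Z22:(7.13)` (summand) OBJECT: the weight-times-character-sum of (7.13) at a triple `(d,h,r)`,
`(dhφ(hr)√r)⁻¹ Σ*_{θ mod r} |𝔰(r,h,d;θ)|`. [cite: Zhang2022LandauSiegel, §7 (7.13) p.37, tex L2005] -/
def term713 (c' : ℝ) (D : ℕ) (a₁ : ℕ → ℂ) (x : ℕ × ℕ × ℕ) : ℝ :=
  (((x.1 * x.2.1 : ℕ) : ℝ) * (Nat.totient (x.2.1 * x.2.2) : ℝ) * Real.sqrt x.2.2)⁻¹ *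
    ∑ θ : DirichletCharacter ℂ x.2.2, if θ.IsPrimitive then ‖frakS c' D a₁ x.2.2 x.2.1 x.1 θ‖ else 0

/-- `Z22:(7.13)` CLAIM. "Inserting this into (7.12) we obtain
`Σ_{p∼P} p^{β₃}𝔗₁₂(p) ≪ Σ′_{d,h,r} (dhφ(hr)√r)⁻¹ Σ*_{θ mod r} |𝔰(r,h,d;θ)|` (7.13)", `Σ′` over
`tripleSet` (`dhr < P₁`, `r > 1`). Refines `Skeleton.Ded71 c′` ((7.12) → (7.13)).
[cite: Zhang2022LandauSiegel, §7 (7.13) p.37, tex L2005] -/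
def Eq713 (c' : ℝ) : Prop :=
  ∀ B : ℝ, ∃ C : ℝ, Skeleton.ForAllLarge fun D _ χ => Skeleton.AssumptionA D χ →
    ∀ a₁ a₂ : ℕ → ℂ, Skeleton.Adm72 D B a₁ → Skeleton.Adm72 D B a₂ →
      ‖∑ p ∈ Skeleton.primeWindow D, (p : ℂ) ^ Skeleton.beta3 c' D * Iface.frakT12 c' D p a₁ a₂‖
        ≤ C * ∑ x ∈ tripleSet D, term713 c' D a₁ x

/-! ## (7.14) and the terms with `1 < r < D` -/

/-- `Z22:(7.14)` (lead-in prose, tex L2008) OBJECT: the tail `l > P²` of `𝔰(r,h,d;θ)`,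
`Σ_{l>P², (l,h)=1} (κ∗a₁)(dl)θ(l) Σ_{p∼P} p^{β₃}θ̄(p)Δ(l/(phr))`.
[cite: Zhang2022LandauSiegel, §7 p.38, tex L2008] -/
def tail7P2 (c' : ℝ) (D : ℕ) (a₁ : ℕ → ℂ) (r h d : ℕ) (θ : DirichletCharacter ℂ r) : ℂ :=
  ∑' l : ℕ,
    if Skeleton.bigP D ^ 2 < (l : ℝ) ∧ Nat.Coprime l h then
      MeanSquareMajorant.conv (Skeleton.kappaZ c' D) a₁ (d * l) * θ (l : ZMod r) *
        ∑ p ∈ Skeleton.primeWindow D, (p : ℂ) ^ Skeleton.beta3 c' D * θ⁻¹ (p : ZMod r) *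
          Skeleton.DeltaW D ((l : ℝ) / ((p : ℝ) * h * r))
    else 0

/-- `Z22:(7.14)` (lead-in prose, tex L2008) CLAIM. "By Lemma 5.3, for `dhr < P₁`, the terms in
`𝔰(r,h,d;θ)` with `l > P²` make a negligible error" — "negligible" typed as `≤ exp(−c𝓛¹⁰)` (the
manuscript's `ε`, tex L1062; AMBIGUITY: "negligible" is not quantified in print), for `θ` primitive
`(mod r)`, `r > 1` (the context of `Σ*`). Input named: `Skeleton.Lemma53`.
[cite: Zhang2022LandauSiegel, §7 p.38, tex L2008] -/
def Step7bTruncP2 (c' : ℝ) : Prop :=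
  ∀ B : ℝ, ∃ c : ℝ, 0 < c ∧ Skeleton.ForAllLarge fun D _ χ => Skeleton.AssumptionA D χ →
    ∀ a₁ : ℕ → ℂ, Skeleton.Adm72 D B a₁ →
      ∀ (d h r : ℕ) (θ : DirichletCharacter ℂ r), (d, h, r) ∈ tripleSet D → θ.IsPrimitive →
        ‖tail7P2 c' D a₁ r h d θ‖ ≤ Real.exp (-c * Skeleton.ell D ^ 10)

/-- `Z22:§7.u038`–`§7.u040` OBJECT: the prime polynomial `Σ_{p∼P} θ̄(p)p^{s}` for a character
`θ (mod r)` (at `s = 1 + it + β₃` in (7.14), §7.u038; "`p ≃ P`" in §7.u037–u040 is read as `p ∼ P` —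
AMBIGUITY: `≃` is not defined as a range in the manuscript).
[cite: Zhang2022LandauSiegel, §7 (7.14) p.38, tex L2010] -/
def pPoly (D r : ℕ) (θ : DirichletCharacter ℂ r) (s : ℂ) : ℂ :=
  ∑ p ∈ Skeleton.primeWindow D, θ⁻¹ (p : ZMod r) * (p : ℂ) ^ s

/-- `Z22:(7.14)` CLAIM. "By the Mellin transform and Lemma 5.4 (i),
`Σ_{p∼P} p^{β₃}θ̄(p)Δ(l/(phr)) ≪ 𝓛^c hrl⁻¹ ∫_{−∞}^{∞} |Σ_{p∼P} p^{1+it+β₃}θ̄(p)| dt/(1+t²)` (7.14)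
for `l ≤ P²`" (`h, r, l ≥ 1`, any character `θ (mod r)`). Inputs named: Mellin inversion for `Δ/δ`
((5.14)), `Skeleton.Lemma54` (i). [cite: Zhang2022LandauSiegel, §7 (7.14) p.38, tex L2009] -/
def Eq714 (c' : ℝ) : Prop :=
  ∃ k : ℕ, ∃ C : ℝ, Skeleton.ForAllLarge fun D _ χ => Skeleton.AssumptionA D χ →
    ∀ (r h l : ℕ) (θ : DirichletCharacter ℂ r), 0 < r → 0 < h → 0 < l →
      (l : ℝ) ≤ Skeleton.bigP D ^ 2 →
        ‖∑ p ∈ Skeleton.primeWindow D, (p : ℂ) ^ Skeleton.beta3 c' D * θ⁻¹ (p : ZMod r) *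
            Skeleton.DeltaW D ((l : ℝ) / ((p : ℝ) * h * r))‖
          ≤ C * Skeleton.ell D ^ k * (((h * r : ℕ) : ℝ) / l) *
              ∫ t : ℝ, ‖pPoly D r θ (1 + t * I + Skeleton.beta3 c' D)‖ / (1 + t ^ 2)

/-- `Z22:§7.u033` CLAIM. "Assume `1 < r < D` and `θ` is a primitive character `(mod r)`. By Lemma 5.6,
the right side of (7.14) is `≪ hrl⁻¹P²D^{−c}`" — for every exponent `k` of the unspecified `𝓛^c`
in (7.14) there are `c > 0`, `C` with `𝓛^k hrl⁻¹ ∫ … ≤ C hrl⁻¹ P² D^{−c}`. Input named: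
`Skeleton.Lemma56` (a tree theorem, `Skeleton.lemma56_holds`, range `|t| ≤ D`); the `|t| > D` part of
the integral is covered by no cited input (prior read1-9) — typed AS PRINTED.
[cite: Zhang2022LandauSiegel, §7 p.38, tex L2015] -/
def Step7u033 (c' : ℝ) : Prop :=
  ∀ k : ℕ, ∃ c : ℝ, 0 < c ∧ ∃ C : ℝ, Skeleton.ForAllLarge fun D _ χ => Skeleton.AssumptionA D χ →
    ∀ (r h l : ℕ) (θ : DirichletCharacter ℂ r), 1 < r → r < D → θ.IsPrimitive → 0 < h → 0 < l →
      Skeleton.ell D ^ k * (((h * r : ℕ) : ℝ) / l) *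
          (∫ t : ℝ, ‖pPoly D r θ (1 + t * I + Skeleton.beta3 c' D)‖ / (1 + t ^ 2))
        ≤ C * (((h * r : ℕ) : ℝ) / l) * Skeleton.bigP D ^ 2 * (D : ℝ) ^ (-c)

/-- `Z22:§7.u034` CLAIM. "Hence `𝔰(r,h,d;θ) ≪ τ₅(d)hrP²D^{−c}`" (for `1 < r < D`, `θ` primitive
`(mod r)`, `(d,h,r)` in the range of `Σ′`; `τ₅` = `MeanSquareMajorant.tau 5`).
[cite: Zhang2022LandauSiegel, §7 p.38, tex L2019] -/
def Step7u034 (c' : ℝ) : Prop :=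
  ∀ B : ℝ, ∃ c : ℝ, 0 < c ∧ ∃ C : ℝ, Skeleton.ForAllLarge fun D _ χ => Skeleton.AssumptionA D χ →
    ∀ a₁ : ℕ → ℂ, Skeleton.Adm72 D B a₁ →
      ∀ (d h r : ℕ) (θ : DirichletCharacter ℂ r), (d, h, r) ∈ tripleSet D → r < D →
        θ.IsPrimitive →
          ‖frakS c' D a₁ r h d θ‖ ≤
            C * MeanSquareMajorant.tau 5 d * ((h * r : ℕ) : ℝ) * Skeleton.bigP D ^ 2 * (D : ℝ) ^ (-c)

/-- `Z22:(7.15)` (lead-in prose, tex L2022) CLAIM. "Thus, on the right side of (7.13), the total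
contribution from the terms with `1 < r < D` is `O(P²D^{−c})`."
[cite: Zhang2022LandauSiegel, §7 p.38, tex L2022] -/
def Step7bSmallR (c' : ℝ) : Prop :=
  ∀ B : ℝ, ∃ c : ℝ, 0 < c ∧ ∃ C : ℝ, Skeleton.ForAllLarge fun D _ χ => Skeleton.AssumptionA D χ →
    ∀ a₁ : ℕ → ℂ, Skeleton.Adm72 D B a₁ →
      ∑ x ∈ (tripleSet D).filter (fun x => x.2.2 < D), term713 c' D a₁ x ≤
        C * Skeleton.bigP D ^ 2 * (D : ℝ) ^ (-c)

/-! ## (7.15), the interval `𝔌(y)` and `𝔰*` -/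

/-- `Z22:§7.u035` OBJECT (the standing ranges of (7.15)): "`dh < P₁` and `D ≤ R < (dh)⁻¹P₁`, which
are henceforth assumed" (`R` the dyadic parameter of `R ≤ r < 2R`).
[cite: Zhang2022LandauSiegel, §7 (7.15) p.38, tex L2028] -/
def InRange735 (D d h : ℕ) (R : ℝ) : Prop :=
  ((d * h : ℕ) : ℝ) < Skeleton.P1 D ∧ (D : ℝ) ≤ R ∧ R < Skeleton.P1 D / ((d * h : ℕ) : ℝ)

open scoped Classical in
/-- `Z22:(7.15)` CLAIM. "The proof of (7.11) is therefore reduced to showing that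
`R^{−3/2} Σ_{R≤r<2R} Σ*_{θ mod r} |𝔰(r,h,d;θ)| ≪ τ₅(d)hP²D^{−c}` (7.15) for `dh < P₁` and
`D ≤ R < (dh)⁻¹P₁`" (`d, h ≥ 1`). Refines `Skeleton.Ded71 c′` (the target of §7.u036–u041).
[cite: Zhang2022LandauSiegel, §7 (7.15) p.38, tex L2024] -/
def Eq715 (c' : ℝ) : Prop :=
  ∀ B : ℝ, ∃ c : ℝ, 0 < c ∧ ∃ C : ℝ, Skeleton.ForAllLarge fun D _ χ => Skeleton.AssumptionA D χ →
    ∀ a₁ : ℕ → ℂ, Skeleton.Adm72 D B a₁ → ∀ (d h : ℕ) (R : ℝ), 0 < d → 0 < h →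
      InRange735 D d h R →
        R ^ (-(3 / 2 : ℝ)) * ∑ r ∈ dyadic R, ∑ θ : DirichletCharacter ℂ r,
            (if θ.IsPrimitive then ‖frakS c' D a₁ r h d θ‖ else 0) ≤
          C * MeanSquareMajorant.tau 5 d * (h : ℝ) * Skeleton.bigP D ^ 2 * (D : ℝ) ^ (-c)

/-- `Z22:§7.u036` OBJECT `𝔌(y)`: "the interval `[(1/3)Pt₀y, 4Pt₀y]`".
[cite: Zhang2022LandauSiegel, §7 p.38, tex L2033] -/
def frakI (D : ℕ) (y : ℝ) : Set ℝ :=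
  Set.Icc (1 / 3 * Skeleton.bigP D * Skeleton.t0 D * y) (4 * Skeleton.bigP D * Skeleton.t0 D * y)

open scoped Classical in
/-- `Z22:§7.u036` OBJECT: the positive integers `l ∈ 𝔌(y)` (a finite set).
[cite: Zhang2022LandauSiegel, §7 p.38, tex L2033] -/
def natI (D : ℕ) (y : ℝ) : Finset ℕ :=
  (Finset.range (⌊4 * Skeleton.bigP D * Skeleton.t0 D * y⌋₊ + 1)).filter
    fun l => 0 < l ∧ (l : ℝ) ∈ frakI D y

/-- `Z22:§7.u037` OBJECT `𝔰*(R,r,h,d;θ)`: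
"`𝔰*(R,r,h,d;θ) := Σ_{l∈𝔌(Rh), (l,h)=1} (κ∗a₁)(dl)θ(l) Σ_{p≃P} θ̄(p)p^{β₃}Δ(l/(phr))`"
(a finite sum; "`p ≃ P`" read as `p ∼ P`, see `pPoly`).
[cite: Zhang2022LandauSiegel, §7 p.38, tex L2039] -/
def frakSstar (c' : ℝ) (D : ℕ) (a₁ : ℕ → ℂ) (R : ℝ) (r h d : ℕ) (θ : DirichletCharacter ℂ r) : ℂ :=
  ∑ l ∈ (natI D (R * h)).filter (fun l => Nat.Coprime l h),
    MeanSquareMajorant.conv (Skeleton.kappaZ c' D) a₁ (d * l) * θ (l : ZMod r) *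
      ∑ p ∈ Skeleton.primeWindow D, θ⁻¹ (p : ZMod r) * (p : ℂ) ^ Skeleton.beta3 c' D *
        Skeleton.DeltaW D ((l : ℝ) / ((p : ℝ) * h * r))

/-- `Z22:§7.u037` (lead-in prose, tex L2036) CLAIM. "By Lemma 5.1, for `R ≤ r < 2R`, the terms with
`l ∉ 𝔌(Rh)` in `𝔰(r,h,d;θ)` make a negligible contribution" — typed as
`|𝔰(r,h,d;θ) − 𝔰*(R,r,h,d;θ)| ≤ exp(−c𝓛¹⁰)` under the ranges of (7.15), `θ` primitive (AMBIGUITY: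
"negligible" as in `Step7bTruncP2`; the printed "Lemma 5.1" names the `Δ`-localisation of Lemma 5.3
(5.8)–(5.9), prior read1-13 (vi) — inputs `Skeleton.Lemma51`, `Skeleton.Lemma53`).
[cite: Zhang2022LandauSiegel, §7 p.38, tex L2036] -/
def Step7bTruncI (c' : ℝ) : Prop :=
  ∀ B : ℝ, ∃ c : ℝ, 0 < c ∧ Skeleton.ForAllLarge fun D _ χ => Skeleton.AssumptionA D χ →
    ∀ a₁ : ℕ → ℂ, Skeleton.Adm72 D B a₁ → ∀ (d h : ℕ) (R : ℝ), 0 < d → 0 < h →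
      InRange735 D d h R → ∀ r ∈ dyadic R, ∀ θ : DirichletCharacter ℂ r, θ.IsPrimitive →
        ‖frakS c' D a₁ r h d θ - frakSstar c' D a₁ R r h d θ‖ ≤ Real.exp (-c * Skeleton.ell D ^ 10)

/-! ## `§7.u038`–`§7.u041`: Mellin bound, large sieve, Cauchy -/

/-- `Z22:§7.u038`–`§7.u039` OBJECT: the `l`-polynomial
`Σ_{l∈𝔌(Rh), (l,h)=1} (κ∗a₁)(dl)θ(l)l^{−s}` for a character `θ (mod r)`.
[cite: Zhang2022LandauSiegel, §7 p.38, tex L2044] -/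
def lPoly (c' : ℝ) (D : ℕ) (a₁ : ℕ → ℂ) (R : ℝ) (r h d : ℕ) (θ : DirichletCharacter ℂ r)
    (s : ℂ) : ℂ :=
  ∑ l ∈ (natI D (R * h)).filter (fun l => Nat.Coprime l h),
    MeanSquareMajorant.conv (Skeleton.kappaZ c' D) a₁ (d * l) * θ (l : ZMod r) * (l : ℂ) ^ (-s)

/-- `Z22:§7.u038` CLAIM. "By the Mellin transform and Lemma 5.4 (i),
`𝔰*(R,r,h,d;θ) ≪ 𝓛^c ∫_{−∞}^{∞} |Σ_{l∈𝔌(Rh),(l,h)=1} (κ∗a₁)(dl)θ(l)l^{−1−it}| ·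
|Σ_{p≃P} θ̄(p)p^{1+it+β₃}| dt/(1+t²)`" (under the ranges of (7.15), `R ≤ r < 2R`, any `θ (mod r)`).
Input named: `Skeleton.Lemma54` (i). [cite: Zhang2022LandauSiegel, §7 p.38, tex L2043] -/
def Step7u038 (c' : ℝ) : Prop :=
  ∀ B : ℝ, ∃ k : ℕ, ∃ C : ℝ, Skeleton.ForAllLarge fun D _ χ => Skeleton.AssumptionA D χ →
    ∀ a₁ : ℕ → ℂ, Skeleton.Adm72 D B a₁ → ∀ (d h : ℕ) (R : ℝ), 0 < d → 0 < h →
      InRange735 D d h R → ∀ r ∈ dyadic R, ∀ θ : DirichletCharacter ℂ r,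
        ‖frakSstar c' D a₁ R r h d θ‖ ≤
          C * Skeleton.ell D ^ k *
            ∫ t : ℝ, ‖lPoly c' D a₁ R r h d θ (1 + t * I)‖ *
              ‖pPoly D r θ (1 + t * I + Skeleton.beta3 c' D)‖ / (1 + t ^ 2)

open scoped Classical in
/-- `Z22:§7.u039` CLAIM. "For `σ = 1`, by the large sieve inequality we have
`Σ_{R≤r<2R} Σ*_{θ mod r} |Σ_{l∈𝔌(Rh),(l,h)=1} (κ∗a₁)(dl)θ(l)l^{−s}|² ≪ τ₅(d)²𝓛^c(R² + PRht₀)(PRht₀)⁻¹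
≪ τ₅(d)²𝓛^c`" — both bounds, under the ranges of (7.15) (`s = 1 + it`, any real `t`). Input named:
the multiplicative large sieve (FACT-LIST candidate F1 of sz-L2-lead), typed as the manuscript's claim.
[cite: Zhang2022LandauSiegel, §7 p.39, tex L2047] -/
def Step7u039 (c' : ℝ) : Prop :=
  ∀ B : ℝ, ∃ k : ℕ, ∃ C : ℝ, Skeleton.ForAllLarge fun D _ χ => Skeleton.AssumptionA D χ →
    ∀ a₁ : ℕ → ℂ, Skeleton.Adm72 D B a₁ → ∀ (d h : ℕ) (R : ℝ), 0 < d → 0 < h →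
      InRange735 D d h R → ∀ t : ℝ,
        (∑ r ∈ dyadic R, ∑ θ : DirichletCharacter ℂ r,
            (if θ.IsPrimitive then ‖lPoly c' D a₁ R r h d θ (1 + t * I)‖ ^ 2 else 0) ≤
          C * MeanSquareMajorant.tau 5 d ^ 2 * Skeleton.ell D ^ k *
            ((R ^ 2 + Skeleton.bigP D * R * h * Skeleton.t0 D) /
              (Skeleton.bigP D * R * h * Skeleton.t0 D))) ∧
        (R ^ 2 + Skeleton.bigP D * R * h * Skeleton.t0 D) / (Skeleton.bigP D * R * h * Skeleton.t0 D)
          ≤ C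

open scoped Classical in
/-- `Z22:§7.u040` CLAIM. "and `Σ_{R≤r<2R} Σ*_{θ mod r} |Σ_{p≃P} θ̄(p)p^{s}|² ≪ (R² + P)P³`"
(`σ = 1`; `R ≥ 1`). Input named: the multiplicative large sieve (F1), typed as the manuscript's claim.
[cite: Zhang2022LandauSiegel, §7 p.39, tex L2051] -/
def Step7u040 : Prop :=
  ∃ C : ℝ, Skeleton.ForAllLarge fun D _ χ => Skeleton.AssumptionA D χ →
    ∀ R : ℝ, 1 ≤ R → ∀ s : ℂ, s.re = 1 →
      ∑ r ∈ dyadic R, ∑ θ : DirichletCharacter ℂ r,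
          (if θ.IsPrimitive then ‖pPoly D r θ s‖ ^ 2 else 0) ≤
        C * (R ^ 2 + Skeleton.bigP D) * Skeleton.bigP D ^ 3

open scoped Classical in
/-- `Z22:§7.u041` CLAIM. "It follows by Cauchy's inequality that
`R^{−3/2} Σ_{R≤r<2R} Σ*_{θ mod r} |𝔰*(R,r,h,d;θ)| ≪ τ₅(d)h𝓛^c(R^{1/2}P^{3/2} + R^{−1/2}P²) ≪ τ₅(d)hP²D^{−c}`"
— both bounds, under the ranges of (7.15): the first with some exponent `k`; the second for every
exponent `k` with some `c > 0`. [cite: Zhang2022LandauSiegel, §7 p.39, tex L2055] -/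
def Step7u041 (c' : ℝ) : Prop :=
  (∀ B : ℝ, ∃ k : ℕ, ∃ C : ℝ, Skeleton.ForAllLarge fun D _ χ => Skeleton.AssumptionA D χ →
    ∀ a₁ : ℕ → ℂ, Skeleton.Adm72 D B a₁ → ∀ (d h : ℕ) (R : ℝ), 0 < d → 0 < h →
      InRange735 D d h R →
        R ^ (-(3 / 2 : ℝ)) * ∑ r ∈ dyadic R, ∑ θ : DirichletCharacter ℂ r,
            (if θ.IsPrimitive then ‖frakSstar c' D a₁ R r h d θ‖ else 0) ≤
          C * MeanSquareMajorant.tau 5 d * (h : ℝ) * Skeleton.ell D ^ k *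
            (R ^ (1 / 2 : ℝ) * Skeleton.bigP D ^ (3 / 2 : ℝ) +
              R ^ (-(1 / 2 : ℝ)) * Skeleton.bigP D ^ 2)) ∧
  (∀ k : ℕ, ∃ c : ℝ, 0 < c ∧ ∃ C : ℝ, Skeleton.ForAllLarge fun D _ _ =>
    ∀ (d h : ℕ) (R : ℝ), 0 < d → 0 < h → InRange735 D d h R →
      MeanSquareMajorant.tau 5 d * (h : ℝ) * Skeleton.ell D ^ k *
          (R ^ (1 / 2 : ℝ) * Skeleton.bigP D ^ (3 / 2 : ℝ) + R ^ (-(1 / 2 : ℝ)) * Skeleton.bigP D ^ 2)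
        ≤ C * MeanSquareMajorant.tau 5 d * (h : ℝ) * Skeleton.bigP D ^ 2 * (D : ℝ) ^ (-c))

/-! ## The two deductions of the subsection -/

/-- `Z22:(7.15)` (closing prose "This yields (7.15)", tex L2058) DEDUCTION, typed as an implication
over this file's step claims: the `l ∉ 𝔌(Rh)` truncation, the Mellin bound §7.u038, the two
large-sieve bounds §7.u039–u040 and the Cauchy step §7.u041 yield (7.15). CLAIM (an edge to prove).
[cite: Zhang2022LandauSiegel, §7 p.39, tex L2058] -/
def Ded715 (c' : ℝ) : Prop :=
  Step7bTruncI c' → Step7u038 c' → Step7u039 c' → Step7u040 → Step7u041 c' → Eq715 c'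

/-- `Z22:Prop7.1.pf.b-error` DEDUCTION node "*Proof of Proposition 7.1: The error term* — In this
subsection we prove (7.11)": refines `Skeleton.Ded71 c′` (its error-term part) as the implication
from this file's steps (7.12), `|τ(θ̄)| ≤ √r`, §7.u031, (7.13), the `l > P²` truncation, (7.14),
§7.u033, §7.u034, the `1 < r < D` total, and (7.15) (with the dyadic decomposition `R ≥ D` of the
remaining range) to (7.11) (= `Iface.Eq711`, owner L2-t3). CLAIM (an edge to prove); cited inputs of
the block: Lemmas 5.1, 5.3, 5.4, 5.6 (`Skeleton.Lemma51/53/54/56`), (7.2).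
[cite: Zhang2022LandauSiegel, §7 pp.37–39, tex L1984–L2058] -/
def DedProp71b (c' : ℝ) : Prop :=
  Eq712 c' → Step7u031tau → Step7u031 c' → Eq713 c' → Step7bTruncP2 c' → Eq714 c' →
    Step7u033 c' → Step7u034 c' → Step7bSmallR c' → Eq715 c' → Iface.Eq711 c'

end Literature.NumberTheory.LFunctions.Zhang2022.Section7cStatements
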